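import Mathlib.RingTheory.Flat.Basic
import Literature.AlgebraicGeometry.Motives.FamiliesVHS

/-!
# The integral lattice of a VHS datum injects into the rational fibre (proofs)

This file discharges the named fact
`Literature.AlgebraicGeometry.Motives.VHSData.toRat_injective` of
`Literature/AlgebraicGeometry/Motives/FamiliesVHS.lean`:

* `Literature.AlgebraicGeometry.Motives.VHSData.toRat_injective_holds : D.toRat_injective` —
  for every point `s`, the comparison map `V_ℤ,s → V_s`, `u ↦ ratIso⁻¹ (1 ⊗ u)`, is injective.

Source: W. Schmid, *Variation of Hodge structure: the singularities of the period mapping*,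
Invent. Math. 22 (1973), 211–319, §2, where a variation of Hodge structure carries a flat
bundle of lattices `H_ℤ ⊂ H_ℚ = H_ℤ ⊗ ℚ` (the integral structure is a lattice in the rational
one); the same convention `𝓛_ℚ := 𝓛_ℤ ⊗ ℚ` for a local system `𝓛_ℤ` of `ℤ`-modules of finite
type is E. Cattani, F. El Zein, P. Griffiths, Lê D. T., *Hodge Theory* (Princeton Math. Notes
49, 2014), Def. 8.1.13 (ii). The content is the elementary algebraic fact that a free (hence
flat, indeed torsion-free) abelian group `L` embeds into `ℚ ⊗_ℤ L` by `u ↦ 1 ⊗ u`.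

## Proof

* `tmul_right_injective_of_flat`: for a flat `R`-module `M` and a vector `x ∈ N` whose orbit
  map `r ↦ r • x : R → N` is injective, `m ↦ x ⊗ m : M → N ⊗_R M` is injective — it factors as
  `M ≃ R ⊗_R M → N ⊗_R M`, the second map being `(r ↦ r • x) ⊗ 𝟙_M`, injective by flatness
  (Mathlib `Module.Flat.rTensor_preserves_injective_linearMap`).
* `oneTmul_injective`: `V_ℤ,s` is free (`VHSData.free`), hence flat, and `r ↦ r • 1 = r : ℤ → ℚ`
  is injective, so `u ↦ 1 ⊗ u : V_ℤ,s → ℚ ⊗ V_ℤ,s` is injective.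
* `toRat_injective_holds`: `toRat = ratIso⁻¹ ∘ (1 ⊗ ·)` and `ratIso⁻¹` is a fibrewise isomorphism.

## References

* W. Schmid, *Variation of Hodge structure: the singularities of the period mapping*, Invent.
  Math. 22 (1973), 211–319, §2.
* E. Cattani, F. El Zein, P. A. Griffiths, Lê D. T. (eds.), *Hodge Theory*, Princeton
  Mathematical Notes 49 (2014), Def. 8.1.13.
-/

open CategoryTheory
open scoped TensorProduct ChangeOfRings

noncomputable section

namespace Literature.AlgebraicGeometry.Motives

namespace VHSData

/-- For a flat `R`-module `M` and a vector `x ∈ N` whose orbit map `r ↦ r • x : R → N` is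
injective, the map `m ↦ x ⊗ m : M → N ⊗_R M` is injective: it is the composite of
`M ≃ R ⊗_R M` with `(r ↦ r • x) ⊗ 𝟙_M`, which is injective by flatness of `M`
(Mathlib `Module.Flat.rTensor_preserves_injective_linearMap`). [folklore] -/
theorem tmul_right_injective_of_flat {R : Type*} [CommSemiring R] {N : Type*} [AddCommMonoid N]
    [Module R N] {M : Type*} [AddCommMonoid M] [Module R M] [Module.Flat R M] {x : N}
    (hx : Function.Injective fun r : R => r • x) :
    Function.Injective fun m : M => x ⊗ₜ[R] m := by
  have hx' : Function.Injective (LinearMap.toSpanSingleton R N x) := fun a b h => hx (by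
    simpa only [LinearMap.toSpanSingleton_apply] using h)
  have h : (fun m : M => x ⊗ₜ[R] m) =
      (LinearMap.toSpanSingleton R N x).rTensor M ∘ (TensorProduct.lid R M).symm := by
    funext m
    simp [LinearMap.rTensor_tmul, LinearMap.toSpanSingleton_apply]
  rw [h]
  exact (Module.Flat.rTensor_preserves_injective_linearMap _ hx').comp
    (TensorProduct.lid R M).symm.injective

variable {S : Type} [TopologicalSpace S] {n : ℤ} (D : VHSData S n)

/-- The map `u ↦ 1 ⊗ u : V_ℤ,s → V_ℤ,s ⊗ ℚ` is injective: `V_ℤ,s` is a free, hence flat,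
`ℤ`-module and `ℤ → ℚ` is injective (Schmid 1973, §2: `H_ℤ` is a lattice in
`H_ℚ = H_ℤ ⊗ ℚ`). [cite: Schmid1973, §2] -/
theorem oneTmul_injective (s : S) : Function.Injective (D.oneTmul s) := by
  haveI : Module.Free ℤ (D.VZ.fiber s) := D.free s
  refine tmul_right_injective_of_flat (R := ℤ) ?_
  intro a b h
  have h' : ((a : ℚ) * 1 : ℚ) = ((b : ℚ) * 1 : ℚ) := h
  exact_mod_cast (by simpa using h')

/-- The fibrewise components of `ratIso⁻¹ : V_ℤ ⊗ ℚ ≅ V` are injective (they are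
isomorphisms of `ℚ`-vector spaces). [folklore] -/
theorem ratIso_inv_app_injective (s : S) :
    Function.Injective (D.ratIso.inv.app ⟨s⟩).hom :=
  (D.ratIso.app ⟨s⟩).symm.toLinearEquiv.injective

/-- **Discharge of `VHSData.toRat_injective`**: for every `s ∈ S` the comparison map
`V_ℤ,s → V_s`, `u ↦ ratIso⁻¹ (1 ⊗ u)`, is injective, i.e. the integral structure is a lattice
in the rational local system (Schmid 1973, §2: `H_ℚ = H_ℤ ⊗_ℤ ℚ ⊃ H_ℤ`; algebraically: a free
abelian group is flat over `ℤ`, so `V_ℤ,s → ℚ ⊗ V_ℤ,s` is injective, and `ratIso⁻¹` is an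
isomorphism). [cite: Schmid1973, §2] -/
theorem toRat_injective_holds : D.toRat_injective := by
  intro s u v huv
  rw [toRat_apply, toRat_apply] at huv
  exact D.oneTmul_injective s (D.ratIso_inv_app_injective s huv)

end VHSData

end Literature.AlgebraicGeometry.Motives

end
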